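import Literature.Computability.AlgebraicComplexity.LMRDetThreeIdealModule
import Literature.Computability.AlgebraicComplexity.OrbitMultiplicitySemigroup
import HarnessLib

/-!
# Landsberg–Manivel–Ressayre: the explicit module of equations of `\overline{GL_{n²}·det_n}` in
# degree `2n(n−1)`, for every `n ≥ 3` (a cited fact), its first-row ray, and the certificate shapes

Topic `Computability/AlgebraicComplexity` (geometric complexity theory). Companion of
`LMRDetThreeIdealModule.lean` (cell `pub-gct`, the `n = 3` instance `LMR2013_detThree_idealHwv` of the
same printed theorem, filed with the line "TODO(general form): Thm. 1.1.2 (1) for every `n ≥ 3`, with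
`λ(n) = (2n³−4n²+1, 2n²−4n+1, 2^{2n−1}) ⊢ 2n²(n−1)` in degree `2n(n−1)`") — this file IS that general
form. Written for the sibling cell `pub-gct-max` (HOME `run/shared/lean/pub/pub-gct-max/`, track T),
whose obstruction scan reads the `n = 4` instance `λ(4) = (65, 17, 2⁷) ⊢ 96` at degree `24`
(the "LMR row" `(65,17,2⁷)@⟨3,4,24⟩` of `OBSTRUCTION-SCAN.md` §R, lead D268/D347). Honest framing of
that cell: multiplicity data and certified rank bounds at small parameters; occurrence obstructions
are ruled out in print (BIP 2019) — multiplicity obstructions are the open door; nothing here is a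
claim on VP ≠ VNP or P ≠ NP.

**Source (as printed).** J. M. Landsberg, L. Manivel, N. Ressayre, *Hypersurfaces with degenerate
duals and the geometric complexity theory program*, Comment. Math. Helv. **88** (2013) 469–484.
* Thm. 1.1.2 (p. 470) `[corpus:paper:galaxy-pdf-8572435590081880720 p0002 L15–19]`: "Consider the
  ideal of regular functions on `S^n(M_n(ℂ)^*)` that are zero on `\overline{GL_{n²}·[det_n]}`. We
  construct an explicit sub-`GL_{n²}`-module `V_n` in this ideal which has the following properties.
  (1) The `GL_{n²}`-module `V_n` contains an irreducible module of highest weight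
  `2n(n−1)(n−2)ω_1 + (2n² − 4n − 1)ω_2 + 2ω_{2n+1}` and `V_n` is a subspace of the space of
  homogeneous polynomials of degree `n(n−1)` [sic, see ERRATA] on `S^n(M_n(ℂ))^*`. (2) The variety
  `\overline{GL_{n²}·[det_n]}` is an irreducible component of the zero locus `𝒟_n` of `V_n`."
* §3.2 (p. 476) `[p0008 L3–7]`: "A copy of the module with highest weight
  `2n(n−1)(n−2)ω_1 + (2n²−4n−1)ω_2 + 2ω_{2n+1}` in `S^{2n(n−1)}(S^n ℂ^{n²})` is in the ideal of
  `\overline{GL(W)·[det_n]}`. … For example, when `n = 3`, the module with highest weight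
  `12ω_1 + 5ω_2 + 2ω_7` occurs with multiplicity six in `S^{12}(S^3ℂ^9)`, but only one copy of it is in
  the ideal."
* Mechanism (not vendored): Thm. 2.3.1 (p. 474) `[p0006 L33–37]` "The variety
  `Dual_{k,d,N} ⊂ ℙ(S^d(ℂ^N)^*)` has equations given by a copy of the `SL_N`-module with highest weight
  `Ω(k,d) = (d−1)(d−2)(k+2)ω_1 + (d(k+2)−2k−5)ω_2 + 2ω_{k+3}`. These equations have degree
  `(k+2)(d−1)`." and Thm. 3.1.1 (p. 476) (`[det_n] ∈ Dual_{2n−2,n,n²}`: the dual of the determinant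
  hypersurface is the rank-one locus, of dimension `2n − 2`); with `k = 2n−2`, `d = n`, `N = n²`:
  `Ω(2n−2,n) = 2n(n−1)(n−2)ω_1 + (2n²−4n−1)ω_2 + 2ω_{2n+1}`, degree `2n(n−1)`.

ERRATA recorded (immaterial to the Lean statement, in which the weight pins the degree):
(i) Thm. 1.1.2 (1) prints "degree `n(n−1)`" (journal p. 470 and arXiv:1004.4802 alike) where §3.1
("of degree `2n(n−1)`"), §3.2 ("in `S^{2n(n−1)}(S^nℂ^{n²})`") and Thm. 2.3.1 ("degree `(k+2)(d−1)`")
give `2n(n−1)`; the weight has `|λ(n)| = 2n²(n−1) = n · 2n(n−1)` boxes, which forces degree `2n(n−1)`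
(`12`, not `6`, at `n = 3`). (ii) The arXiv abstract-version `[corpus:paper:arxiv-1004.4802 p0003 L45,
p0006 L49]` prints the first coefficient as "`n(n−1)(n−2)ω_1`"; the journal's `2n(n−1)(n−2)ω_1` is
the one consistent with the printed `n = 3` example `12ω_1` and with `Ω(2n−2, n)`.

**Dictionary** (as in `LMRDetThreeIdealModule.lean`). As a partition of `n · 2n(n−1)` with at most
`n²` parts the highest weight is `λ(n) = (2n³−4n²+1, 2n²−4n+1, 2, …, 2)` (`2n−1` parts equal to `2`,
`2n+1` parts in all; `λ(3) = (19,7,2⁵) ⊢ 36`, `λ(4) = (65,17,2⁷) ⊢ 96`). LMR's hypersurfaces are points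
of `S^n W^*`, so their equations in `S^e(S^n W)` have POLYNOMIAL types `S_π W`; the tree's coordinate
ring `coordRep (MatIdx n) ℂ n` (`OrbitCoordinateRing.lean`) carries the contragredient action, whose
irreducible types are the DUAL weights `π^*`
(`exists_eq_dualOfPartition_of_hasHighestWeight_coordRep`); since the ideal of the orbit closure is
stable under the whole group, "a copy of `S_π W` lies in the ideal" (LMR) is "the ideal contains a
nonzero highest-weight vector of weight `π^*`" (tree; lexicographic upper Borel on `MatIdx n`, weight
`(Weight.dualOfPartition (n*n) λ).toMatIdx = partitionWeightLex n λ`, the convention of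
`PerDetMultiplicityObstructionAt` and of the `n = 3` file).

**What is vendored** (ONE named fact): `LMR2013_thm_1_1_2_1` — for every `n ≥ 3` a nonzero
highest-weight vector of weight `λ(n)^*` of `coordRep (MatIdx n) ℂ n` lies in
`orbitVanishingIdeal (detFormLex ℂ n) n`. Not vendored: part (2) (irreducible component; no tree
vocabulary for it is needed by any user), the module `V_n` itself, "only one copy" at `n = 3` (an
exact count; see `LMR2013_thm_1_1_2_1.finrank_hwv_inf_idealDet_eq_one_of_rank` for how a det-side
rank certificate pins it). Why a fact and not a theorem: the printed proof goes through the equations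
of hypersurfaces with degenerate dual varieties (Hessians restricted to `(2n+1)`-planes, a
divisibility condition, Thm. 2.3.1) and the duality `Z(det_n)^∨ = Seg(ℙ^{n−1} × ℙ^{n−1})`; none of
this is in the tree, and the highest-weight vector written out in coordinates is far beyond kernel
evaluation already at `n = 3`.

**What is proved here** (from the fact and the tree; `n ≥ 3` throughout):
* `LMR2013_thm_1_1_2_1.detThree_idealHwv` — the tree's `n = 3` fact IS the instance
  (`lmrPartition 3 = lmrPartitionThree`);
* `….orbitMultiplicity_det_lt_plethysmCoeff` — `mult_{λ(n)^*} ℂ[Δ(det_n)] < a_{λ(n)}(2n(n−1)[n])`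
  ("`q_det ≥ 1`": `….one_le_finrank_hwv_inf_idealDet`);
* the FIRST-ROW RAY (Bürgisser–Ikenmeyer 2013 Prop. 3.3 counted, the tree's
  `finrank_hwv_inf_orbitVanishingIdeal_le_add_nsmul` / `…_lowerTop_le` of
  `OrbitMultiplicitySemigroup.lean`): for every `j`, the type `(2n³−4n²+1 + n j, 2n²−4n+1, 2^{2n−1})`
  in degree `2n(n−1) + j` also carries an equation of `Δ(det_n)` and has `mult < a`
  (`….one_le_finrank_hwv_inf_idealDet_add_nsmul`, `….orbitMultiplicity_det_add_nsmul_lt_plethysmCoeff`,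
  weight form; `….of_lowerTop_eq`, partition form) — at `n = 4` this is the cell's "LMR chain"
  `(4d′ − 31, 17, 2⁷) @ d′` for every `d′ ≥ 24`;
* certificate shapes, permanent size `m ≤ n` padded by `X₀₀^{n−m}` (`paddedPerFormLex ℂ m n`):
  `….perDetMultiplicityObstructionAt_of_rank` (`a ≤ r ≤ mult_per ⇒ (m, n, 2n(n−1), λ(n))` is a
  multiplicity obstruction), `….lt_dc_per_of_rank` (`⇒ dc(per_m) > n`),
  `….finrank_hwv_inf_idealDet_eq_one_of_rank` (a det-side rank `r′` with `a ≤ r′ + 1` pins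
  `mult_det + 1 = a` and `#eq = 1`);
* the `n = 4` row of the scan: `lmrPartition_four_parts` (`(65,17,2,2,2,2,2,2,2)`),
  `….perDetMultiplicityObstructionAt_three_four_of_rank` — granted the fact, a permanent-side rank
  `r` with `a_{(65,17,2⁷)}(24[4]) ≤ r ≤ mult_{λ(4)^*} ℂ[Δ_4(X₀₀ per_3)]` makes `(3, 4, 24, (65,17,2⁷))` a
  multiplicity obstruction (the separation `X₀₀·per_3 ∉ Δ(det_4)` itself is LMR Thm. 1.1.1, the
  tree's `LMR2013_thm_1_1_1_holds`; the content is the representation-theoretic row). No rank, no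
  value of `a` is asserted in this file.

## References
* [LandsbergManivelRessayre2013] J. M. Landsberg, L. Manivel, N. Ressayre, Comment. Math. Helv. 88
  (2013) 469–484 (doi:10.4171/CMH/292; arXiv:1004.4802), Thm. 1.1.2 (p. 470), Thm. 2.3.1 (p. 474),
  Thm. 3.1.1 and §3.2 (p. 476).
* [BurgisserIkenmeyer2013] P. Bürgisser, C. Ikenmeyer, STOC 2013 = arXiv:1210.8368, §3.3 Prop. 3.3
  (the ideal is graded and `G`-stable: equations propagate), §5 (5.1)–(5.2).
* [DorflerIkenmeyerPanova2020] J. Dörfler, C. Ikenmeyer, G. Panova, SIAM J. Appl. Algebra Geom. 4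
  (2020), §5 (multiplicities from explicit highest-weight vectors on both sides).

## Mathlib and tree
Tree: `LMR2013_detThree_idealHwv`, `lmrPartitionThree(_parts)` (`LMRDetThreeIdealModule.lean`);
`orbitMultiplicity_lt_plethysmCoeff_of_mem_orbitVanishingIdeal`,
`orbitMultiplicity_add_finrank_inf_eq_plethysmCoeff`, `PerDetMultiplicityObstructionAt.of_idealHwv`
(`HwvIdealRankBound.lean`); `finrank_hwv_inf_orbitVanishingIdeal_le_add_nsmul`,
`finrank_hwv_inf_orbitVanishingIdeal_lowerTop_le`, `one_le_plethysmCoeff_single_top`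
(`OrbitMultiplicitySemigroup.lean`); `lowerTop`, `secondPart`, `topMatIdx`, `partitionWeightLex`
(`PlethysmStabilityBIP.lean`, `OccurrenceObstructionsBIP.lean`);
`lt_determinantalComplexity_perPoly_of_perDetMultiplicityObstructionAt`
(`PerDetMultiplicityObstruction.lean`). Mathlib: `Nat.Partition.ofSums`, `Nat.Partition.ext`.
-/

noncomputable section

open MvPolynomial

namespace Literature.Computability.AlgebraicComplexity

open _root_.Literature.NumberTheory.DiophantineGeometry
open _root_.Literature.Computability.Complexity

/-! ### The partition `λ(n) = (2n³−4n²+1, 2n²−4n+1, 2^{2n−1}) ⊢ 2n²(n−1) = n · 2n(n−1)` -/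

/-- The parts of the Landsberg–Manivel–Ressayre type for `det_n`: `2n³−4n²+1`, `2n²−4n+1` and `2n−1`
parts equal to `2` — the partition form (at most `n²` parts) of the highest weight
`2n(n−1)(n−2)ω_1 + (2n²−4n−1)ω_2 + 2ω_{2n+1}` (`λ_1 − λ_2 = 2n(n−1)(n−2)`, `λ_2 − λ_3 = 2n²−4n−1`,
`λ_{2n+1} − λ_{2n+2} = 2`). [cite: LandsbergManivelRessayre2013, Thm. 1.1.2 (1) (p. 470)] -/
def lmrParts (n : ℕ) : Multiset ℕ :=
  (2 * n ^ 3 - 4 * n ^ 2 + 1) ::ₘ (2 * n ^ 2 - 4 * n + 1) ::ₘ Multiset.replicate (2 * n - 1) 2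

/-- The parts sum to `n · 2n(n−1) = 2n²(n−1)` boxes (for `n ≥ 2`; the theorem concerns `n ≥ 3`).
[cite: LandsbergManivelRessayre2013, §3.2 (p. 476)] -/
theorem lmrParts_sum {n : ℕ} (hn : 2 ≤ n) : (lmrParts n).sum = n * (2 * n * (n - 1)) := by
  obtain ⟨k, rfl⟩ := Nat.exists_eq_add_of_le' hn
  simp only [lmrParts, Multiset.sum_cons, Multiset.sum_replicate, smul_eq_mul]
  have h1 : 4 * (k + 2) ^ 2 ≤ 2 * (k + 2) ^ 3 := by nlinarith
  have h2 : 4 * (k + 2) ≤ 2 * (k + 2) ^ 2 := by nlinarith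
  have h3 : 1 ≤ 2 * (k + 2) := by omega
  have h4 : 1 ≤ k + 2 := by omega
  zify [h1, h2, h3, h4]
  ring

/-- **The LMR partition `λ(n) ⊢ n · 2n(n−1)`** (typed, like every per/det certificate of the tree,
as `Nat.Partition (m * d)` with `m = n` the determinant size and `d = 2n(n−1)` the degree). For
`n < 2` — where no such partition exists — the definition returns the one-part partition (junk,
never used: the theorem is about `n ≥ 3`). [cite: LandsbergManivelRessayre2013, Thm. 1.1.2 (1) (p. 470)] -/
def lmrPartition (n : ℕ) : Nat.Partition (n * (2 * n * (n - 1))) :=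
  if h : 2 ≤ n then Nat.Partition.ofSums _ (lmrParts n) (lmrParts_sum h)
  else Nat.Partition.indiscrete _

/-- Unfolding: for `n ≥ 2` the parts of `lmrPartition n` are `lmrParts n` (all of them are nonzero).
[cite: LandsbergManivelRessayre2013, Thm. 1.1.2 (1) (p. 470)] -/
theorem lmrPartition_parts {n : ℕ} (hn : 2 ≤ n) : (lmrPartition n).parts = lmrParts n := by
  rw [lmrPartition, dif_pos hn, Nat.Partition.ofSums_parts]
  exact Multiset.filter_eq_self.2 fun x hx => by
    simp only [lmrParts, Multiset.mem_cons, Multiset.mem_replicate] at hx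
    rcases hx with rfl | rfl | ⟨_, rfl⟩
    · exact Nat.add_one_ne_zero _
    · exact Nat.add_one_ne_zero _
    · exact two_ne_zero

/-- `λ(n)` has `2n + 1` parts. [cite: LandsbergManivelRessayre2013, Thm. 1.1.2 (1) (p. 470)] -/
theorem card_parts_lmrPartition {n : ℕ} (hn : 2 ≤ n) : (lmrPartition n).parts.card = 2 * n + 1 := by
  rw [lmrPartition_parts hn, lmrParts, Multiset.card_cons, Multiset.card_cons, Multiset.card_replicate]
  omega

/-- For `n ≥ 3`, `λ(n)` has at most `n²` parts (the side condition of
`PerDetMultiplicityObstructionAt`; `2n + 1 ≤ n²` fails only at `n = 2`).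
[cite: LandsbergManivelRessayre2013, Thm. 1.1.2 (1) (p. 470)] -/
theorem card_parts_lmrPartition_le {n : ℕ} (hn : 3 ≤ n) : (lmrPartition n).parts.card ≤ n * n := by
  rw [card_parts_lmrPartition (by omega)]
  nlinarith

/-- `λ(3) = (19, 7, 2, 2, 2, 2, 2)`. [cite: LandsbergManivelRessayre2013, §3.2 (p. 476)] -/
theorem lmrPartition_three_parts :
    (lmrPartition 3).parts = (([19, 7, 2, 2, 2, 2, 2] : List ℕ) : Multiset ℕ) := by
  rw [lmrPartition_parts (by norm_num)]
  decide

/-- `λ(3)` is the tree's `lmrPartitionThree` of `LMRDetThreeIdealModule.lean`.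
[cite: LandsbergManivelRessayre2013, §3.2 (p. 476)] -/
theorem lmrPartition_three : lmrPartition 3 = lmrPartitionThree :=
  Nat.Partition.ext (by rw [lmrPartition_three_parts, lmrPartitionThree_parts])

/-- `λ(4) = (65, 17, 2, 2, 2, 2, 2, 2, 2) ⊢ 96 = 4 · 24` — the type of the cell's "LMR row"
`(65,17,2⁷)@⟨3,4,24⟩`. [cite: LandsbergManivelRessayre2013, Thm. 1.1.2 (1) (p. 470)] -/
theorem lmrPartition_four_parts :
    (lmrPartition 4).parts = (([65, 17, 2, 2, 2, 2, 2, 2, 2] : List ℕ) : Multiset ℕ) := by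
  rw [lmrPartition_parts (by norm_num)]
  decide

/-- `λ(4)` has `9 ≤ 16` parts. [cite: LandsbergManivelRessayre2013, Thm. 1.1.2 (1) (p. 470)] -/
theorem card_parts_lmrPartition_four : (lmrPartition 4).parts.card = 9 := by
  rw [card_parts_lmrPartition (by norm_num)]

/-! ### The cited fact: Thm. 1.1.2 (1) with §3.2, every `n ≥ 3` -/

/-- **Landsberg–Manivel–Ressayre 2013, Thm. 1.1.2 (1) with §3.2, for every `n ≥ 3`** (cited fact):
"Consider the ideal of regular functions on `S^n(M_n(ℂ)^*)` that are zero on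
`\overline{GL_{n²}·[det_n]}`. We construct an explicit sub-`GL_{n²}`-module `V_n` in this ideal which
has the following properties. (1) The `GL_{n²}`-module `V_n` contains an irreducible module of highest
weight `2n(n−1)(n−2)ω_1 + (2n² − 4n − 1)ω_2 + 2ω_{2n+1}` …" (p. 470); "A copy of the module with
highest weight `2n(n−1)(n−2)ω_1 + (2n²−4n−1)ω_2 + 2ω_{2n+1}` in `S^{2n(n−1)}(S^n ℂ^{n²})` is in the
ideal of `\overline{GL(W)·[det_n]}`" (§3.2, p. 476). In the tree's vocabulary (dictionary in the module
docstring; same reading as the `n = 3` instance `LMR2013_detThree_idealHwv`): for every `n ≥ 3` some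
NONZERO highest-weight vector of weight `λ(n)^*` (lexicographic upper Borel on `MatIdx n`,
`λ(n) = (2n³−4n²+1, 2n²−4n+1, 2^{2n−1}) ⊢ n · 2n(n−1)`, `lmrPartition n`) of
`coordRep (MatIdx n) ℂ n = ℂ[Sym^n(ℂ^{n²})]` lies in `orbitVanishingIdeal (detFormLex ℂ n) n`, the
ideal of functions vanishing on `GL_{n²} · det_n` (the weight pins the degree `2n(n−1)`). The
restriction `n ≥ 3` is the paper's setting (`ω_{2n+1}` needs `2n + 1 ≤ n²`). The module is LMR's
`V_n` = the equations of hypersurfaces with dual variety of dimension `≤ 2n − 2` (Thm. 2.3.1 with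
`k = 2n−2`, `d = n`, `N = n²`), which vanish on `[det_n]` because `Z(det_n)^∨` is the rank-one locus
(Thm. 3.1.1). [cite: LandsbergManivelRessayre2013, Thm. 1.1.2 (1) (p. 470) and §3.2 (p. 476)] -/
def LMR2013_thm_1_1_2_1 : Prop :=
  ∀ (n : ℕ) [NeZero n], 3 ≤ n →
    ∃ F : MvPolynomial (DegIdx (MatIdx n) n) ℂ, F ≠ 0 ∧
      F ∈ highestWeightSpace (coordRep (MatIdx n) ℂ n) (partitionWeightLex n (lmrPartition n)) ∧
      F ∈ orbitVanishingIdeal (detFormLex ℂ n) n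

/-- **The tree's `n = 3` fact is the instance `n = 3`** of Thm. 1.1.2 (1): granted
`LMR2013_thm_1_1_2_1`, `LMR2013_detThree_idealHwv` (`LMRDetThreeIdealModule.lean`) holds
(`lmrPartition 3 = lmrPartitionThree = (19,7,2⁵)`). [cite: LandsbergManivelRessayre2013, §3.2 (p. 476)] -/
theorem LMR2013_thm_1_1_2_1.detThree_idealHwv (h : LMR2013_thm_1_1_2_1) :
    LMR2013_detThree_idealHwv := by
  obtain ⟨F, hF0, hF, hI⟩ := h 3 (le_refl 3)
  refine ⟨F, hF0, ?_, hI⟩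
  rwa [lmrPartition_three] at hF

/-! ### Consequences on the determinant side: one equation, and its first-row ray -/

section Consequences

variable {n : ℕ} [NeZero n]

/-- **`q_det ≥ 1`**: granted the fact, for `n ≥ 3` the weight-`λ(n)^*` highest-weight vectors of
`ℂ[Sym^n(ℂ^{n²})]` that vanish on `GL_{n²} · det_n` form a space of dimension at least `1`.
[cite: LandsbergManivelRessayre2013, §3.2 (p. 476)] -/
theorem LMR2013_thm_1_1_2_1.one_le_finrank_hwv_inf_idealDet (h : LMR2013_thm_1_1_2_1)
    (hn : 3 ≤ n) :
    1 ≤ Module.finrank ℂ ↥(highestWeightSpace (coordRep (MatIdx n) ℂ n)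
        (partitionWeightLex n (lmrPartition n)) ⊓
      (orbitVanishingIdeal (detFormLex ℂ n) n).restrictScalars ℂ) := by
  obtain ⟨F, hF0, hF, hI⟩ := h n hn
  have hlt := orbitMultiplicity_lt_plethysmCoeff_of_mem_orbitVanishingIdeal (NeZero.ne n) hF hI hF0
  have hrn := orbitMultiplicity_add_finrank_inf_eq_plethysmCoeff (k := ℂ) (detFormLex ℂ n)
    (m := n) (NeZero.ne n) (partitionWeightLex n (lmrPartition n))
  omega

/-- **Consequence on the determinant side**: granted the fact, for `n ≥ 3` the multiplicity of type
`λ(n)` in `ℂ[Δ(det_n)]_{2n(n−1)}` is strictly below the plethysm coefficient `a_{λ(n)}(2n(n−1)[n])`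
(LMR §3.2: the isotypic component is NOT entirely in the ideal — "This does not occur for the module
with highest weight …" — so this is a multiplicity datum, not an occurrence obstruction).
[cite: LandsbergManivelRessayre2013, §3.2 (p. 476)] -/
theorem LMR2013_thm_1_1_2_1.orbitMultiplicity_det_lt_plethysmCoeff (h : LMR2013_thm_1_1_2_1)
    (hn : 3 ≤ n) :
    orbitMultiplicity ℂ (detFormLex ℂ n) n (partitionWeightLex n (lmrPartition n)) <
      plethysmCoeff ℂ (MatIdx n) n (partitionWeightLex n (lmrPartition n)) := by
  obtain ⟨F, hF0, hF, hI⟩ := h n hn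
  exact orbitMultiplicity_lt_plethysmCoeff_of_mem_orbitVanishingIdeal (NeZero.ne n) hF hI hF0

/-- **The first-row ray, weight form — equations.** Granted the fact, for `n ≥ 3` and every `j`,
`Δ(det_n)` has a highest-weight equation of weight `λ(n)^* + j·(−n ε_top)`, the dual weight of the
partition `(2n³−4n²+1 + n j, 2n²−4n+1, 2^{2n−1}) ⊢ n(2n(n−1) + j)` (first row lengthened by `n j`,
degree `2n(n−1) + j`; `partitionWeightLex_lowerTop_add_nsmul_single`): multiply LMR's equation by the
`j`-th power of the coordinate of `x_top^n` (Bürgisser–Ikenmeyer 2013 Prop. 3.3: the ideal is graded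
and `G`-stable; counted form `finrank_hwv_inf_orbitVanishingIdeal_le_add_nsmul`). At `n = 4`: every
type `(4d′ − 31, 17, 2⁷)` with `d′ ≥ 24` carries an equation of `\overline{GL_{16}·det_4}`.
[cite: BurgisserIkenmeyer2013, §3.3 Prop. 3.3] -/
theorem LMR2013_thm_1_1_2_1.one_le_finrank_hwv_inf_idealDet_add_nsmul (h : LMR2013_thm_1_1_2_1)
    (hn : 3 ≤ n) (j : ℕ) :
    1 ≤ Module.finrank ℂ ↥(highestWeightSpace (coordRep (MatIdx n) ℂ n)
        (partitionWeightLex n (lmrPartition n) + j • (Pi.single (topMatIdx n) (-(n : ℤ)))) ⊓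
      (orbitVanishingIdeal (detFormLex ℂ n) n).restrictScalars ℂ) := by
  haveI : Infinite ℂ := CharZero.infinite ℂ
  exact (h.one_le_finrank_hwv_inf_idealDet hn).trans
    (finrank_hwv_inf_orbitVanishingIdeal_le_add_nsmul (detFormLex ℂ n) (NeZero.ne n)
      (partitionWeightLex n (lmrPartition n))
      (one_le_plethysmCoeff_single_top (k := ℂ) (NeZero.ne n) (topMatIdx n) (le_topMatIdx n)) j)

/-- **The first-row ray, weight form — multiplicities.** Granted the fact, for `n ≥ 3` and every
`j`: `mult_{λ(n)^* + j(−n ε_top)} ℂ[Δ(det_n)] < a_{λ(n)^* + j(−n ε_top)}` — no type on the first-row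
ray of `λ(n)` is full for `det_n` (rank–nullity `mult + #eq = a`,
`orbitMultiplicity_add_finrank_inf_eq_plethysmCoeff`). [cite: BurgisserIkenmeyer2013, §3.3 Prop. 3.3] -/
theorem LMR2013_thm_1_1_2_1.orbitMultiplicity_det_add_nsmul_lt_plethysmCoeff
    (h : LMR2013_thm_1_1_2_1) (hn : 3 ≤ n) (j : ℕ) :
    orbitMultiplicity ℂ (detFormLex ℂ n) n
        (partitionWeightLex n (lmrPartition n) + j • (Pi.single (topMatIdx n) (-(n : ℤ)))) <
      plethysmCoeff ℂ (MatIdx n) n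
        (partitionWeightLex n (lmrPartition n) + j • (Pi.single (topMatIdx n) (-(n : ℤ)))) := by
  have h1 := h.one_le_finrank_hwv_inf_idealDet_add_nsmul hn j
  have hrn := orbitMultiplicity_add_finrank_inf_eq_plethysmCoeff (k := ℂ) (detFormLex ℂ n)
    (m := n) (NeZero.ne n)
    (partitionWeightLex n (lmrPartition n) + j • (Pi.single (topMatIdx n) (-(n : ℤ))))
  omega

/-- **The first-row ray, partition form.** Granted the fact, `n ≥ 3`: if a partition `μ ⊢ D`,
`D = n·2n(n−1) + n j`, with `μ₂ + n j ≤ μ₁` has first-row shortening `lowerTop μ (n j) = λ(n)` — i.e.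
`μ = (2n³−4n²+1 + n j, 2n²−4n+1, 2^{2n−1})` — then `μ` carries an equation of `Δ(det_n)` and
`mult_{μ^*} ℂ[Δ(det_n)] < a_{μ^*}` (`finrank_hwv_inf_orbitVanishingIdeal_lowerTop_le` of
`OrbitMultiplicitySemigroup.lean`). The cell's reading at `n = 4`: along the "LMR chain"
`(4d′−31, 17, 2⁷)@d′` the determinant column has `#eq ≥ 1` for every `d′ ≥ 24`, by theorem modulo
the cited fact. [cite: BurgisserIkenmeyer2013, §3.3 Prop. 3.3] -/
theorem LMR2013_thm_1_1_2_1.of_lowerTop_eq (h : LMR2013_thm_1_1_2_1) (hn : 3 ≤ n) {D : ℕ}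
    (mu : Nat.Partition D) (j : ℕ) (hD : n * (2 * n * (n - 1)) + n * j = D)
    (hr : secondPart mu + n * j ≤ mu.parts.sup)
    (hmu : lowerTop mu (n * j) (n * (2 * n * (n - 1))) hD hr = lmrPartition n) :
    1 ≤ Module.finrank ℂ ↥(highestWeightSpace (coordRep (MatIdx n) ℂ n) (partitionWeightLex n mu) ⊓
        (orbitVanishingIdeal (detFormLex ℂ n) n).restrictScalars ℂ) ∧
      orbitMultiplicity ℂ (detFormLex ℂ n) n (partitionWeightLex n mu) <
        plethysmCoeff ℂ (MatIdx n) n (partitionWeightLex n mu) := by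
  haveI : Infinite ℂ := CharZero.infinite ℂ
  have hle := finrank_hwv_inf_orbitVanishingIdeal_lowerTop_le (k := ℂ) (detFormLex ℂ n)
    (NeZero.ne n) mu j hD hr
  rw [hmu] at hle
  have h1 := (h.one_le_finrank_hwv_inf_idealDet hn).trans hle
  have hrn := orbitMultiplicity_add_finrank_inf_eq_plethysmCoeff (k := ℂ) (detFormLex ℂ n)
    (m := n) (NeZero.ne n) (partitionWeightLex n mu)
  exact ⟨h1, by omega⟩

/-! ### Certificate shapes: the padded permanent `X₀₀^{n−m} per_m`, `m ≤ n` -/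

/-- **The `(m, n, 2n(n−1), λ(n))` certificate shape**: granted the fact, `3 ≤ n`, `m ≤ n`, if
`a_{λ(n)}(2n(n−1)[n]) ≤ r` and `r ≤ mult_{λ(n)^*} ℂ[Δ_n(X₀₀^{n−m} per_m)]` (an evaluation rank at
points of `GL_{n²} · X₀₀^{n−m} per_m`, e.g. via `le_orbitMultiplicity_of_det_eval_ne_zero` — NOT
asserted here), then `λ(n)` is a multiplicity obstruction for `det_n` versus the padded permanent:
`mult_det < a ≤ r ≤ mult_per`. Via `PerDetMultiplicityObstructionAt.of_idealHwv` with `s = 1`.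
[cite: LandsbergManivelRessayre2013, Thm. 1.1.2 (1) (p. 470)] -/
theorem LMR2013_thm_1_1_2_1.perDetMultiplicityObstructionAt_of_rank (h : LMR2013_thm_1_1_2_1)
    (hn : 3 ≤ n) {m : ℕ} (hmn : m ≤ n) {r : ℕ}
    (ha : plethysmCoeff ℂ (MatIdx n) n (partitionWeightLex n (lmrPartition n)) ≤ r)
    (hr : r ≤ orbitMultiplicity ℂ (paddedPerFormLex ℂ m n) n
      (partitionWeightLex n (lmrPartition n))) :
    PerDetMultiplicityObstructionAt (k := ℂ) m n (2 * n * (n - 1)) (lmrPartition n) := by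
  obtain ⟨F, hF0, hF, hI⟩ := h n hn
  exact PerDetMultiplicityObstructionAt.of_idealHwv (s := 1) (r := r) hmn
    (card_parts_lmrPartition_le hn) (fun _ : Fin 1 => F) (fun _ => hF) (fun _ => hI)
    (linearIndependent_unique_iff.mpr hF0) (Nat.lt_succ_of_le ha) hr

/-- With the fact and such a permanent-side rank, `dc(per_m) > n` follows formally
(`lt_determinantalComplexity_perPoly_of_perDetMultiplicityObstructionAt`).
[cite: LandsbergManivelRessayre2013, Thm. 1.1.2 (1) (p. 470)] -/
theorem LMR2013_thm_1_1_2_1.lt_dc_per_of_rank (h : LMR2013_thm_1_1_2_1) (hn : 3 ≤ n) {m : ℕ}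
    (hmn : m ≤ n) {r : ℕ}
    (ha : plethysmCoeff ℂ (MatIdx n) n (partitionWeightLex n (lmrPartition n)) ≤ r)
    (hr : r ≤ orbitMultiplicity ℂ (paddedPerFormLex ℂ m n) n
      (partitionWeightLex n (lmrPartition n))) :
    n < determinantalComplexity (perPoly (Fin m) ℂ) :=
  lt_determinantalComplexity_perPoly_of_perDetMultiplicityObstructionAt
    (h.perDetMultiplicityObstructionAt_of_rank hn hmn ha hr)

/-- **A det-side rank certificate pins LMR's copy as the only one.** Granted the fact (one copy in
the ideal: `#eq ≥ 1`), a determinant-side evaluation rank `r′ ≤ mult_{λ(n)^*} ℂ[Δ(det_n)]` with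
`a ≤ r′ + 1` gives `mult_{λ(n)^*} ℂ[Δ(det_n)] + 1 = a_{λ(n)}` and `#eq = 1` exactly (rank–nullity).
For `n = 3` this is the printed "occurs with multiplicity six … but only one copy of it is in the
ideal" (§3.2), certified modulo the cited existence of one copy; for `n = 4` nothing about `#eq` is
printed (the cell's `q_det(24) ≥ 1`, lead D347). [cite: LandsbergManivelRessayre2013, §3.2 (p. 476)] -/
theorem LMR2013_thm_1_1_2_1.finrank_hwv_inf_idealDet_eq_one_of_rank (h : LMR2013_thm_1_1_2_1)
    (hn : 3 ≤ n) {r' : ℕ}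
    (ha : plethysmCoeff ℂ (MatIdx n) n (partitionWeightLex n (lmrPartition n)) ≤ r' + 1)
    (hr' : r' ≤ orbitMultiplicity ℂ (detFormLex ℂ n) n (partitionWeightLex n (lmrPartition n))) :
    orbitMultiplicity ℂ (detFormLex ℂ n) n (partitionWeightLex n (lmrPartition n)) + 1 =
        plethysmCoeff ℂ (MatIdx n) n (partitionWeightLex n (lmrPartition n)) ∧
      Module.finrank ℂ ↥(highestWeightSpace (coordRep (MatIdx n) ℂ n)
            (partitionWeightLex n (lmrPartition n)) ⊓
          (orbitVanishingIdeal (detFormLex ℂ n) n).restrictScalars ℂ) = 1 := by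
  have hlt := h.orbitMultiplicity_det_lt_plethysmCoeff hn
  have hrn := orbitMultiplicity_add_finrank_inf_eq_plethysmCoeff (k := ℂ) (detFormLex ℂ n)
    (m := n) (NeZero.ne n) (partitionWeightLex n (lmrPartition n))
  omega

end Consequences

/-! ### The `n = 4` row of the obstruction scan: `(65,17,2⁷)@⟨3,4,24⟩` -/

/-- **The LMR row of the cell `pub-gct-max`**: granted the fact, a permanent-side rank certificate
`r` with `a_{(65,17,2⁷)}(24[4]) ≤ r ≤ mult_{(65,17,2⁷)^*} ℂ[Δ_4(X₀₀ · per_3)]` (the cell's event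
"`r_Z = a` certified"; its `a = 274` is a computed number, not used here) makes
`(3, 4, 24, (65,17,2⁷))` a multiplicity obstruction for `det_4` versus `X₀₀ · per_3`:
`mult_det ≤ a − 1 < a ≤ mult_per`. The separation `X₀₀ · per_3 ∉ Δ(det_4)` is LMR Thm. 1.1.1
(`LMR2013_thm_1_1_1_holds`); what such a row adds is an explicit representation-theoretic witness.
[cite: LandsbergManivelRessayre2013, Thm. 1.1.2 (1) (p. 470)] -/
theorem LMR2013_thm_1_1_2_1.perDetMultiplicityObstructionAt_three_four_of_rank
    (h : LMR2013_thm_1_1_2_1) {r : ℕ}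
    (ha : plethysmCoeff ℂ (MatIdx 4) 4 (partitionWeightLex 4 (lmrPartition 4)) ≤ r)
    (hr : r ≤ orbitMultiplicity ℂ (paddedPerFormLex ℂ 3 4) 4 (partitionWeightLex 4 (lmrPartition 4))) :
    PerDetMultiplicityObstructionAt (k := ℂ) 3 4 24 (lmrPartition 4) :=
  h.perDetMultiplicityObstructionAt_of_rank (by norm_num) (by norm_num) ha hr

/-- … and then `dc(per_3) > 4` formally (known: `dc(per_3) = 7`, Alper–Bogart–Velasco; and
`\overline{dc}(per_3) ≥ 5`, LMR Thm. 1.1.1). [cite: LandsbergManivelRessayre2013, Thm. 1.1.2 (1) (p. 470)] -/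
theorem LMR2013_thm_1_1_2_1.four_lt_dc_perThree_of_rank (h : LMR2013_thm_1_1_2_1) {r : ℕ}
    (ha : plethysmCoeff ℂ (MatIdx 4) 4 (partitionWeightLex 4 (lmrPartition 4)) ≤ r)
    (hr : r ≤ orbitMultiplicity ℂ (paddedPerFormLex ℂ 3 4) 4 (partitionWeightLex 4 (lmrPartition 4))) :
    4 < determinantalComplexity (perPoly (Fin 3) ℂ) :=
  h.lt_dc_per_of_rank (by norm_num) (by norm_num) ha hr

/-- Usability check of the partition form at `n = 4`, `j = 1` (the chain member `(69,17,2⁷) ⊢ 100`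
at `d′ = 25`): its first-row shortening by `4` is `λ(4)`, by evaluation. -/
example :
    lowerTop (Nat.Partition.ofSums (4 * 25) ((([69, 17, 2, 2, 2, 2, 2, 2, 2] : List ℕ) : Multiset ℕ))
        (by decide)) (4 * 1) (4 * (2 * 4 * (4 - 1))) (by decide) (by decide) =
      lmrPartition 4 := by
  rw [Nat.Partition.ext_iff, lowerTop_parts, lmrPartition_four_parts, Nat.Partition.ofSums_parts]
  decide

end Literature.Computability.AlgebraicComplexity
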